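import Summits.AtomisticToContinuum.Crystallization.Theorems.ThreeConeCertificateExactCertificateTangency
import Summits.AtomisticToContinuum.Crystallization.Theorems.ThreeConeCertificateExactCertificateFieldCompetitors

/-!
# `ExactCertificate` (stmt-AtomisticToContinuum-11959): the DILATION DEFECT of a witness

Line `closure-makes-nogap-exact`, continuation lead c2 (registered stub `stub_dilationDefect`, Field chain V).

For a witness `(P, ρ, c, g, U, f)` of the crux (`IsSplit ρ c g U f`, `c + f 0/2 ≤ −e(P)`) and every
`t > 0`:

  `0 ≤ f 0 + 2·e_P(f(t·)) ≤ (e₆(P)/6)·(t⁻⁶ − 1)²`.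

Mechanism: the dilate `t • P` is a periodic competitor (`Dilation.stub_dilate`: `e_W(t • P) = e_{W(t·)}(P)`
for every pair potential `W`), so by competitor neutrality (`Field.stub_competitorNeutrality`: for every
periodic `Q`, `0 ≤ f 0 + 2e_f(Q) ≤ 2(e(Q) − e(P))`) its `f`-sum is squeezed by twice its excess energy, and the
excess of a dilate is explicit at zero pressure (`Dilation.stub_zeroPressure` (iii), applicable since a witness
template does not gain under dilation, `Contact.le_energyPerParticle_dilate`):
`e_{LJ(t·)}(P) − e_LJ(P) = (e₆(P)/12)(t⁻⁶ − 1)²`.  Second-order vanishing at `t = 1` is the Fourier-free form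
of "𝓕f has DOUBLE zeros at every Bragg radius of P".  All `[folklore]`.
-/

noncomputable section

namespace Summit.AtomisticToContinuum.Crystallization.Theorems.ThreeConeCertificateExactCertificate.Field

open Literature.MathematicalPhysics.StatisticalMechanics
open Summit.AtomisticToContinuum.Crystallization.Theorems.ExactCertificateNegative (IsSplit)
open Summit.AtomisticToContinuum.Crystallization.Theorems.ThreeConeCertificateExactCertificate.Dilation
  (stub_dilate stub_zeroPressure)
open Summit.AtomisticToContinuum.Crystallization.Theorems.ThreeConeCertificateExactCertificate.Contact
  (le_energyPerParticle_dilate)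
open scoped BigOperators

/-- **The `f`-sum of a dilated witness template is squeezed by the dilation excess**: for a witness and
`t > 0`, `0 ≤ f 0 + 2e_P(f(t·)) ≤ 2(e_{LJ(t·)}(P) − e_LJ(P))` (competitor neutrality at `Q = t • P`).
[folklore] -/
theorem dilate_neutrality_le {P : PeriodicConfiguration 3} {ρ c : ℝ} {g U f : ℝ → ℝ}
    (h : IsSplit ρ c g U f) (hv : c + f 0 / 2 ≤ -(P.energyPerParticle lennardJones)) {t : ℝ} (ht : 0 < t) :
    0 ≤ f 0 + 2 * P.energyPerParticle (fun r => f (t * r)) ∧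
      f 0 + 2 * P.energyPerParticle (fun r => f (t * r)) ≤
        2 * (P.energyPerParticle (fun r => lennardJones (t * r)) - P.energyPerParticle lennardJones) := by
  obtain ⟨Q, -, -, hQ⟩ := stub_dilate P t ht
  have hc := stub_competitorNeutrality P Q ρ c g U f h hv
  rw [hQ f, hQ lennardJones] at hc
  exact hc

/-- **Registered stub `stub_dilationDefect` of crux item stmt-AtomisticToContinuum-11959 (line
`closure-makes-nogap-exact`, Field chain V; signature verbatim): DILATION DEFECT** — for a witness and every
`t > 0`, `0 ≤ f 0 + 2e_P(f(t·)) ≤ (e₆(P)/6)(t⁻⁶ − 1)²` (second-order vanishing at `t = 1`; Fourier-free form of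
double zeros of `𝓕f` at the Bragg radii). [folklore] -/
theorem stub_dilationDefect : ∀ (P : PeriodicConfiguration 3) (ρ c : ℝ) (g U f : ℝ → ℝ),
    Summit.AtomisticToContinuum.Crystallization.Theorems.ExactCertificateNegative.IsSplit ρ c g U f →
    c + f 0 / 2 ≤ -(P.energyPerParticle lennardJones) → ∀ t : ℝ, 0 < t →
    0 ≤ f 0 + 2 * P.energyPerParticle (fun r => f (t * r)) ∧
      f 0 + 2 * P.energyPerParticle (fun r => f (t * r)) ≤
        (1 / 6) * P.energyPerParticle (fun r => (r⁻¹) ^ 6) * ((t⁻¹) ^ 6 - 1) ^ 2 := by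
  intro P ρ c g U f h hv t ht
  obtain ⟨h0, h1⟩ := dilate_neutrality_le h hv ht
  obtain ⟨-, -, hexc⟩ := stub_zeroPressure P fun s hs => le_energyPerParticle_dilate h hv hs
  have h2 := hexc t ht
  refine ⟨h0, ?_⟩
  calc f 0 + 2 * P.energyPerParticle (fun r => f (t * r))
      ≤ 2 * (P.energyPerParticle (fun r => lennardJones (t * r)) - P.energyPerParticle lennardJones) := h1
    _ = (1 / 6) * P.energyPerParticle (fun r => (r⁻¹) ^ 6) * ((t⁻¹) ^ 6 - 1) ^ 2 := by rw [h2]; ring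

end Summit.AtomisticToContinuum.Crystallization.Theorems.ThreeConeCertificateExactCertificate.Field

end
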